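import Literature.Analysis.FluidPDE.PassiveVectorFourier
import Literature.Analysis.FluidPDE.PassiveScalarDiagUniqueness
import HarnessLib

/-!
# Uniqueness of weak passive-vector / linearised Navier–Stokes solutions with bounded carrier

Analysis/FluidPDE proof-support file (everything proved; no new definitions). For the weak class
`Torus.IsWeakPassiveVectorOn A T ν b w₀ w` (`∂ₜw + (b·∇)w + A (w·∇)b + ∇π = νΔw`, `∇·w = 0`,
`w ∈ L^∞_t L²_x`, tested against smooth divergence-free fields; Yoshida–Kaneda 2000, eq. (4)–(5))
with `ν > 0` and a carrier `b ∈ L^∞((0,T) × T^d)` we prove, for EVERY coupling constant `A`: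

* `IsWeakPassiveVectorOn.sub_of_eq` — linearity: the difference of two solutions with the same
  carrier and datum is a solution with datum `0`;
* `IsWeakPassiveVectorOn.ae_sq_norm_mFourierCoeff_le` — the uniform-in-`k` modewise energy bound
  for datum `0`: `‖ŵ(t)(k)‖² ≤ (2d(1+A²)/ν) ∫_{(0,t]} ∑ⱼ (‖𝓕(bⱼw)(τ)(k)‖² + ‖𝓕(wⱼb)(τ)(k)‖²) dτ`
  for a.e. `t`. It is obtained from the modewise integral identity of `PassiveVectorFourier`
  tested with the `d` transversal vectors `z⁽ⁱ⁾ = |k|² eᵢ - kᵢ k` (for `k ≠ 0`; `eᵢ` for `k = 0`),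
  the one-mode energy lemma `sq_norm_le_of_ae_eq_setIntegral` of `PassiveScalarDiagUniqueness`,
  and the recovery `∑ᵢ |⟪ŵ(k), z⁽ⁱ⁾⟫|² = |k|⁴ ‖ŵ(k)‖²` from `k · ŵ(t)(k) = 0`
  (`IsWeaklyDivFree.sum_mul_mFourierCoeff_eq_zero`) — the Fourier-side Leray projection;
* `IsWeakPassiveVectorOn.ae_eq_zero_of_memLp_top` — a solution with datum `0` vanishes a.e.
  (Plancherel for vector fields, Tonelli, Grönwall a.e. in time `ae_gronwall_const`);
* `IsWeakPassiveVectorOn.ae_eq_of_memLp_top` — **uniqueness**: two solutions with the same datum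
  and the same bounded carrier agree for a.e. `t ∈ (0,T)`.

No regularity of `b` beyond measurability and boundedness is used (no `∇b`: the stretching term
is kept in the weak form `A ⟪b, (w·∇)Ψ⟫`), so the theorem covers Lipschitz-in-time trigonometric
carriers (lattice shear words, crux K2R `RealisedQuasiStaticCellLaw` of route
`SolenoidalFractalHomogenisation`) as well as Hölder carriers. This is the passive-vector analogue
of the bounded-drift uniqueness theorem for scalars (Bonicatto–Ciampa–Crippa 2024, Cor. 3.5 at
`p = ∞`, `q = 2`; scalar twin `PassiveScalarDiagUniqueness`), proved by the Galerkin/modewise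
energy method (Evans 2010, §7.1.2 Thm. 2) rather than by renormalisation.

## Mathlib / tree search

Tree: `PassiveVectorFourier` (modewise identity), `PassiveVectorClass` (class API),
`PassiveScalarDiagUniqueness` (`sq_norm_le_of_ae_eq_setIntegral`), `TorusVectorParseval`
(`tsum_enorm_sq_mFourierCoeff_complexify`), `TorusTrigPoly`
(`IsWeaklyDivFree.sum_mul_mFourierCoeff_eq_zero`), `PerturbedEnergyGronwall.ae_gronwall_const`,
Mathlib: `EuclideanSpace.inner_single_right`,
`PiLp.norm_single`, `EuclideanSpace.norm_sq_eq`, `MemLp.of_le_mul`.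

## References

* K. Yoshida, Y. Kaneda, Phys. Rev. E 63 (2000) 016308, §II eq. (4)–(5). [`YoshidaKaneda2000`]
* P. Bonicatto, G. Ciampa, G. Crippa, J. Math. Pures Appl. 183 (2024), Cor. 3.5. [`BonicattoCiampaCrippa2023`]
* L. C. Evans, *Partial Differential Equations*, 2nd ed. (AMS 2010), §7.1.2 Thm. 2, App. B.2. [`Evans2010`]
* L. Grafakos, *Classical Fourier Analysis*, 3rd ed., GTM 249 (2014), Prop. 3.2.7. [`Grafakos2014`]
* R. J. DiPerna, P.-L. Lions, Invent. Math. 98 (1989), §II.1. [`DiPernaLions1989`]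
-/

noncomputable section

open MeasureTheory Set Filter Function TopologicalSpace Complex UnitAddTorus
open scoped ENNReal NNReal InnerProductSpace ComplexConjugate

namespace Literature.Analysis.FluidPDE

namespace Torus

variable {d : Type*} [Fintype d]

/-! ## Arithmetic of the modewise right-hand side -/

section ModeArithmetic

/-- `(a + |A| b)² ≤ (1 + A²)(a² + b²)` (Cauchy–Schwarz with two terms). [folklore] -/
private theorem sq_add_abs_mul_le (A a b : ℝ) : (a + |A| * b) ^ 2 ≤ (1 + A ^ 2) * (a ^ 2 + b ^ 2) := by
  nlinarith [sq_nonneg (|A| * a - b), sq_abs A]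

/-- **The transport and stretching terms of one mode are controlled by the diffusion symbol**:
for `ν > 0`, vectors `Fⱼ, Gⱼ, z ∈ ℂ^d` and a frequency `k`,
`‖∑ⱼ 2πi kⱼ ⟪Fⱼ, z⟫ + A ∑ⱼ 2πi kⱼ ⟪Gⱼ, z⟫‖² ≤ 2 (4π²ν|k|²) ((1 + A²)‖z‖²/(2ν)) ∑ⱼ (‖Fⱼ‖² + ‖Gⱼ‖²)`
(Cauchy–Schwarz). [folklore] -/
private theorem norm_sq_modeRHS_le {ν : ℝ} (hν : 0 < ν) (A : ℝ) (k : d → ℤ) (z : EuclideanSpace ℂ d)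
    (F G : d → EuclideanSpace ℂ d) :
    ‖(∑ j, (2 * Real.pi * I * (k j)) * ⟪F j, z⟫_ℂ) + (A : ℂ) * ∑ j, (2 * Real.pi * I * (k j)) * ⟪G j, z⟫_ℂ‖ ^ 2 ≤
      2 * (4 * Real.pi ^ 2 * ν * FunctionSpaces.Torus.freqNormSq k) * ((1 + A ^ 2) * ‖z‖ ^ 2 / (2 * ν)) *
        ∑ j, (‖F j‖ ^ 2 + ‖G j‖ ^ 2) := by
  have hkj : ∀ j, ‖(2 * Real.pi * I * (k j) : ℂ)‖ = 2 * Real.pi * |(k j : ℝ)| := by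
    intro j
    rw [norm_mul, norm_mul, norm_mul, Complex.norm_I, mul_one, Complex.norm_intCast, Complex.norm_real,
      Real.norm_eq_abs, abs_of_pos Real.pi_pos, ← Int.cast_abs, Int.cast_abs]
    norm_num
  have h1 : ‖(∑ j, (2 * Real.pi * I * (k j)) * ⟪F j, z⟫_ℂ) + (A : ℂ) * ∑ j, (2 * Real.pi * I * (k j)) * ⟪G j, z⟫_ℂ‖ ≤
      ∑ j, (2 * Real.pi * |(k j : ℝ)|) * (‖z‖ * (‖F j‖ + |A| * ‖G j‖)) := by
    rw [Finset.mul_sum, ← Finset.sum_add_distrib]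
    refine (norm_sum_le _ _).trans (Finset.sum_le_sum fun j _ => ?_)
    have a1 : ‖(2 * Real.pi * I * (k j)) * ⟪F j, z⟫_ℂ‖ ≤ 2 * Real.pi * |(k j : ℝ)| * (‖F j‖ * ‖z‖) := by
      rw [norm_mul, hkj]
      exact mul_le_mul_of_nonneg_left (norm_inner_le_norm _ _) (by positivity)
    have a2 : ‖(A : ℂ) * ((2 * Real.pi * I * (k j)) * ⟪G j, z⟫_ℂ)‖ ≤
        |A| * (2 * Real.pi * |(k j : ℝ)| * (‖G j‖ * ‖z‖)) := by
      rw [norm_mul, norm_mul, hkj, Complex.norm_real, Real.norm_eq_abs]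
      exact mul_le_mul_of_nonneg_left (mul_le_mul_of_nonneg_left (norm_inner_le_norm _ _) (by positivity))
        (abs_nonneg _)
    calc ‖(2 * Real.pi * I * (k j)) * ⟪F j, z⟫_ℂ + (A : ℂ) * ((2 * Real.pi * I * (k j)) * ⟪G j, z⟫_ℂ)‖
        ≤ ‖(2 * Real.pi * I * (k j)) * ⟪F j, z⟫_ℂ‖ + ‖(A : ℂ) * ((2 * Real.pi * I * (k j)) * ⟪G j, z⟫_ℂ)‖ :=
          norm_add_le _ _
      _ ≤ 2 * Real.pi * |(k j : ℝ)| * (‖F j‖ * ‖z‖) + |A| * (2 * Real.pi * |(k j : ℝ)| * (‖G j‖ * ‖z‖)) :=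
          add_le_add a1 a2
      _ = 2 * Real.pi * |(k j : ℝ)| * (‖z‖ * (‖F j‖ + |A| * ‖G j‖)) := by ring
  have h2 : (∑ j, (2 * Real.pi * |(k j : ℝ)|) * (‖z‖ * (‖F j‖ + |A| * ‖G j‖))) ^ 2 ≤
      (∑ j, (2 * Real.pi * |(k j : ℝ)|) ^ 2) * ∑ j, (‖z‖ * (‖F j‖ + |A| * ‖G j‖)) ^ 2 :=
    Finset.sum_mul_sq_le_sq_mul_sq _ _ _
  have h3 : ∑ j, (2 * Real.pi * |(k j : ℝ)|) ^ 2 = 4 * Real.pi ^ 2 * FunctionSpaces.Torus.freqNormSq k := by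
    rw [FunctionSpaces.Torus.freqNormSq, Finset.mul_sum]
    exact Finset.sum_congr rfl fun j _ => by rw [mul_pow, sq_abs]; ring
  have h4 : ∑ j, (‖z‖ * (‖F j‖ + |A| * ‖G j‖)) ^ 2 ≤ ‖z‖ ^ 2 * (1 + A ^ 2) * ∑ j, (‖F j‖ ^ 2 + ‖G j‖ ^ 2) := by
    rw [Finset.mul_sum]
    refine Finset.sum_le_sum fun j _ => ?_
    rw [mul_pow, mul_assoc]
    exact mul_le_mul_of_nonneg_left (sq_add_abs_mul_le A _ _) (sq_nonneg _)
  have h0 : 0 ≤ ∑ j, (2 * Real.pi * |(k j : ℝ)|) * (‖z‖ * (‖F j‖ + |A| * ‖G j‖)) :=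
    Finset.sum_nonneg fun j _ => by positivity
  have e : 2 * (4 * Real.pi ^ 2 * ν * FunctionSpaces.Torus.freqNormSq k) * ((1 + A ^ 2) * ‖z‖ ^ 2 / (2 * ν)) =
      4 * Real.pi ^ 2 * FunctionSpaces.Torus.freqNormSq k * (‖z‖ ^ 2 * (1 + A ^ 2)) := by
    field_simp
  calc ‖(∑ j, (2 * Real.pi * I * (k j)) * ⟪F j, z⟫_ℂ) + (A : ℂ) * ∑ j, (2 * Real.pi * I * (k j)) * ⟪G j, z⟫_ℂ‖ ^ 2
      ≤ (∑ j, (2 * Real.pi * |(k j : ℝ)|) * (‖z‖ * (‖F j‖ + |A| * ‖G j‖))) ^ 2 :=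
        pow_le_pow_left₀ (norm_nonneg _) h1 2
    _ ≤ (∑ j, (2 * Real.pi * |(k j : ℝ)|) ^ 2) * ∑ j, (‖z‖ * (‖F j‖ + |A| * ‖G j‖)) ^ 2 := h2
    _ ≤ (4 * Real.pi ^ 2 * FunctionSpaces.Torus.freqNormSq k) * (‖z‖ ^ 2 * (1 + A ^ 2) * ∑ j, (‖F j‖ ^ 2 + ‖G j‖ ^ 2)) := by
        rw [h3]
        have hN0 := FunctionSpaces.Torus.freqNormSq_nonneg k
        exact mul_le_mul_of_nonneg_left h4 (by positivity)
    _ = 2 * (4 * Real.pi ^ 2 * ν * FunctionSpaces.Torus.freqNormSq k) * ((1 + A ^ 2) * ‖z‖ ^ 2 / (2 * ν)) *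
        ∑ j, (‖F j‖ ^ 2 + ‖G j‖ ^ 2) := by
        rw [e]
        ring

end ModeArithmetic

/-! ## Plancherel for dominated fields; bounded carriers -/

section Slices

/-- `‖f‖₂² = ∫⁻ ‖f‖ₑ²` in `ℝ≥0∞`. [folklore] -/
private theorem eLpNorm_two_pow_two'' {α : Type*} [MeasurableSpace α] {μ : Measure α}
    {E : Type*} [NormedAddCommGroup E] (f : α → E) :
    eLpNorm f 2 μ ^ 2 = ∫⁻ x, ‖f x‖ₑ ^ 2 ∂μ := by
  rw [eLpNorm_eq_lintegral_rpow_enorm_toReal two_ne_zero ENNReal.ofNat_ne_top, ENNReal.toReal_ofNat,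
    ← ENNReal.rpow_natCast, ← ENNReal.rpow_mul]
  norm_num

/-- **A field dominated by an `L²` field, Fourier side**: if `v ∈ L²(T^d; ℝ^d)`, `g` is a.e.
strongly measurable and `‖g‖ ≤ M ‖v‖` a.e. (`M ≥ 0`), then `g ∈ L²` and
`∑ₖ ‖𝓕(complexify ∘ g)(k)‖ₑ² ≤ M² ∫⁻ ‖v‖ₑ²` (Parseval for real vector fields). Used with
`g = bⱼ w` and `g = wⱼ b` for a carrier `‖b‖ ≤ M`. [cite: Grafakos2014, Prop. 3.2.7 (3)] -/
theorem tsum_enorm_sq_mFourierCoeff_le_of_norm_le {v g : UnitAddTorus d → EuclideanSpace ℝ d}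
    (hv : MemLp v 2 volume) (hg : AEStronglyMeasurable g volume) {M : ℝ} (hM : 0 ≤ M)
    (hle : ∀ᵐ x ∂volume, ‖g x‖ ≤ M * ‖v x‖) :
    MemLp g 2 volume ∧
      ∑' k, ‖mFourierCoeff (FunctionSpaces.EuclideanSpace.complexify ∘ g) k‖ₑ ^ 2 ≤
        ENNReal.ofReal (M ^ 2) * ∫⁻ x, ‖v x‖ₑ ^ 2 := by
  have hmem : MemLp g 2 volume := MemLp.of_le_mul hv hg hle
  refine ⟨hmem, ?_⟩
  rw [FunctionSpaces.Torus.tsum_enorm_sq_mFourierCoeff_complexify hmem]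
  calc ∫⁻ x, ‖g x‖ₑ ^ 2 ≤ ∫⁻ x, (ENNReal.ofReal M * ‖v x‖ₑ) ^ 2 := by
        refine lintegral_mono_ae ?_
        filter_upwards [hle] with x hx
        gcongr
        rw [← ofReal_norm, ← ofReal_norm, ← ENNReal.ofReal_mul hM]
        exact ENNReal.ofReal_le_ofReal hx
    _ = ENNReal.ofReal (M ^ 2) * ∫⁻ x, ‖v x‖ₑ ^ 2 := by
        rw [← lintegral_const_mul' _ _ (by simp)]
        refine lintegral_congr fun x => ?_
        rw [mul_pow, ENNReal.ofReal_pow hM]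

/-- An `L^∞` bound on the space–time lift is an a.e. bound on `(0,T) × T^d`. [folklore] -/
private theorem ae_norm_le_prod_of_memLp_top_stLift'' {u : ℝ → UnitAddTorus d → EuclideanSpace ℝ d} {T : ℝ}
    (hu : MemLp (FunctionSpaces.Torus.stLift u) ∞ (volume.restrict (Ioo 0 T ×ˢ univ))) :
    ∃ M : ℝ, 0 ≤ M ∧ ∀ᵐ q ∂(((volume : Measure ℝ).restrict (Ioo 0 T)).prod (volume : Measure (UnitAddTorus d))),
      ‖u q.1 q.2‖ ≤ M := by
  set μ' : Measure (ℝ × EuclideanSpace ℝ d) := volume.restrict (Ioo 0 T ×ˢ univ) with hμ'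
  set M : ℝ := (eLpNorm (FunctionSpaces.Torus.stLift u) ∞ μ').toReal with hM
  have hfin : eLpNorm (FunctionSpaces.Torus.stLift u) ∞ μ' < (⊤ : ℝ≥0∞) := hu.eLpNorm_lt_top
  have hae' : ∀ᵐ p ∂μ', ‖FunctionSpaces.Torus.stLift u p‖ ≤ M := by
    filter_upwards [ae_le_eLpNormEssSup (f := FunctionSpaces.Torus.stLift u) (μ := μ')] with p hp
    rw [← eLpNorm_exponent_top] at hp
    have := ENNReal.toReal_mono hfin.ne hp
    rwa [toReal_enorm] at this
  refine ⟨M, ENNReal.toReal_nonneg, ?_⟩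
  have hprod : μ' = ((volume : Measure ℝ).restrict (Ioo 0 T)).prod volume := by
    rw [hμ', Measure.volume_eq_prod, ← Measure.prod_restrict, Measure.restrict_univ]
  rw [hprod] at hae'
  have hq := MeasureTheory.QuasiMeasurePreserving.prodMap
    (Measure.QuasiMeasurePreserving.id ((volume : Measure ℝ).restrict (Ioo 0 T)))
    (FunctionSpaces.Torus.quasiMeasurePreserving_repr (d := d))
  filter_upwards [hq.ae hae'] with q hq'
  simpa [FunctionSpaces.Torus.stLift] using hq'

/-- Differences of integrable weakly divergence-free fields are weakly divergence free. [folklore] -/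
private theorem isWeaklyDivFree_sub' {u₁ u₂ : UnitAddTorus d → EuclideanSpace ℝ d}
    (h₁ : FunctionSpaces.Torus.IsWeaklyDivFree u₁) (h₂ : FunctionSpaces.Torus.IsWeaklyDivFree u₂)
    (hu₁ : Integrable u₁ volume) (hu₂ : Integrable u₂ volume) :
    FunctionSpaces.Torus.IsWeaklyDivFree (fun x => u₁ x - u₂ x) := by
  intro θ hθ
  simp_rw [inner_sub_left]
  rw [integral_sub (FunctionSpaces.Torus.integrable_inner_of_continuous hu₁ hθ.gradient.continuous)
    (FunctionSpaces.Torus.integrable_inner_of_continuous hu₂ hθ.gradient.continuous), h₁ θ hθ, h₂ θ hθ, sub_zero]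

/-- The Fourier coefficients of the zero field vanish. [folklore] -/
private theorem mFourierCoeff_complexify_zero' (k : d → ℤ) :
    mFourierCoeff (FunctionSpaces.EuclideanSpace.complexify ∘ (0 : UnitAddTorus d → EuclideanSpace ℝ d)) k = 0 := by
  rw [FunctionSpaces.Torus.mFourierCoeff_eq_integral_volume]
  simp

end Slices

/-! ## The modewise energy bound for a weak solution with datum `0` -/

section ModeBound

variable [DecidableEq d]

namespace IsWeakPassiveVectorOn

variable {A T ν : ℝ} {b w : ℝ → UnitAddTorus d → EuclideanSpace ℝ d}

/-- Slice facts for a solution with a carrier bounded by `M` a.e. on `(0,T) × T^d`: for a.e. `τ`,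
`w(τ) ∈ L²` with `∫⁻ ‖w(τ)‖ₑ² ≤ C`, `b(τ)` is measurable with `‖b(τ,·)‖ ≤ M` a.e., and the products
`bⱼ(τ) w(τ)`, `wⱼ(τ) b(τ)` are in `L²` with `∑ₖ ‖𝓕(·)(k)‖ₑ² ≤ M² ∫⁻ ‖w(τ)‖ₑ²`.
[cite: Grafakos2014, Prop. 3.2.7 (3)] -/
theorem ae_tsum_enorm_sq_mFourierCoeff_products_le {w₀ : UnitAddTorus d → EuclideanSpace ℝ d}
    (h : IsWeakPassiveVectorOn A T ν b w₀ w) {M : ℝ} (hM : 0 ≤ M)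
    (hbM : ∀ᵐ q ∂(((volume : Measure ℝ).restrict (Ioo 0 T)).prod (volume : Measure (UnitAddTorus d))),
      ‖b q.1 q.2‖ ≤ M) :
    ∀ᵐ τ ∂(volume.restrict (Ioo 0 T)), MemLp (w τ) 2 volume ∧ ∀ j,
      (∑' k, ‖mFourierCoeff (FunctionSpaces.EuclideanSpace.complexify ∘ fun x => b τ x j • w τ x) k‖ₑ ^ 2 ≤
          ENNReal.ofReal (M ^ 2) * ∫⁻ x, ‖w τ x‖ₑ ^ 2) ∧
        (∑' k, ‖mFourierCoeff (FunctionSpaces.EuclideanSpace.complexify ∘ fun x => w τ x j • b τ x) k‖ₑ ^ 2 ≤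
          ENNReal.ofReal (M ^ 2) * ∫⁻ x, ‖w τ x‖ₑ ^ 2) := by
  filter_upwards [h.ae_memLp_two, h.ae_aestronglyMeasurable_slice, Measure.ae_ae_of_ae_prod hbM] with τ h1 h2 h3
  refine ⟨h1, fun j => ⟨?_, ?_⟩⟩
  · have hg : AEStronglyMeasurable (fun x => b τ x j • w τ x) volume :=
      ((EuclideanSpace.proj j).continuous.comp_aestronglyMeasurable h2.2).smul h2.1
    refine (tsum_enorm_sq_mFourierCoeff_le_of_norm_le h1 hg hM ?_).2
    filter_upwards [h3] with x hx
    show ‖b τ x j • w τ x‖ ≤ M * ‖w τ x‖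
    rw [norm_smul]
    refine mul_le_mul_of_nonneg_right ?_ (norm_nonneg _)
    exact (Real.norm_eq_abs _ ▸ FunctionSpaces.Torus.abs_apply_le_norm (b τ x) j).trans hx
  · have hg : AEStronglyMeasurable (fun x => w τ x j • b τ x) volume :=
      ((EuclideanSpace.proj j).continuous.comp_aestronglyMeasurable h2.1).smul h2.2
    refine (tsum_enorm_sq_mFourierCoeff_le_of_norm_le h1 hg hM ?_).2
    filter_upwards [h3] with x hx
    show ‖w τ x j • b τ x‖ ≤ M * ‖w τ x‖
    rw [norm_smul, mul_comm]
    refine mul_le_mul ?_ ?_ (norm_nonneg _) hM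
    · exact hx
    · exact Real.norm_eq_abs _ ▸ FunctionSpaces.Torus.abs_apply_le_norm (w τ x) j

/-- **Modewise energy bound against one transversal test vector.** For a weak solution with datum
`0`, `ν > 0`, a carrier bounded by `M` a.e., a frequency `k` and a transversal `z` (`k · z = 0`):
for a.e. `t ∈ (0,T)`,
`|⟪ŵ(t)(k), z⟫|² ≤ ((1 + A²)‖z‖²/(2ν)) ∫_{(0,t]} ∑ⱼ (‖𝓕(bⱼ w)(τ)(k)‖² + ‖𝓕(wⱼ b)(τ)(k)‖²) dτ`
(`sq_norm_le_of_ae_eq_setIntegral` applied to the modewise identity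
`PassiveVectorFourier.ae_inner_mFourierCoeff_eq`; one Galerkin mode of Evans 2010, §7.1.2 Thm. 2).
[cite: Evans2010, §7.1.2 Thm. 2] -/
theorem ae_sq_norm_inner_mFourierCoeff_le (h : IsWeakPassiveVectorOn A T ν b 0 w) (hν : 0 < ν)
    {M : ℝ} (hM : 0 ≤ M)
    (hbM : ∀ᵐ q ∂(((volume : Measure ℝ).restrict (Ioo 0 T)).prod (volume : Measure (UnitAddTorus d))),
      ‖b q.1 q.2‖ ≤ M) (k : d → ℤ) {z : EuclideanSpace ℂ d} (hz : ∑ j, (k j : ℂ) * z j = 0) :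
    ∀ᵐ t ∂(volume.restrict (Ioo 0 T)),
      ‖⟪mFourierCoeff (FunctionSpaces.EuclideanSpace.complexify ∘ w t) k, z⟫_ℂ‖ ^ 2 ≤
        ((1 + A ^ 2) * ‖z‖ ^ 2 / (2 * ν)) * ∫ τ in Ioc 0 t, ∑ j,
          (‖mFourierCoeff (FunctionSpaces.EuclideanSpace.complexify ∘ fun x => b τ x j • w τ x) k‖ ^ 2 +
            ‖mFourierCoeff (FunctionSpaces.EuclideanSpace.complexify ∘ fun x => w τ x j • b τ x) k‖ ^ 2) := by
  obtain ⟨C, hC⟩ := h.ae_lintegral_sq_le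
  -- the data of the one-mode lemma
  set ν' : ℝ := 4 * Real.pi ^ 2 * ν * FunctionSpaces.Torus.freqNormSq k with hν'
  set D : ℝ := (1 + A ^ 2) * ‖z‖ ^ 2 / (2 * ν) with hD
  set α : ℝ → ℂ := fun t => ⟪mFourierCoeff (FunctionSpaces.EuclideanSpace.complexify ∘ w t) k, z⟫_ℂ with hα
  set F : d → ℝ → EuclideanSpace ℂ d := fun j τ =>
    mFourierCoeff (FunctionSpaces.EuclideanSpace.complexify ∘ fun x => b τ x j • w τ x) k with hF
  set G : d → ℝ → EuclideanSpace ℂ d := fun j τ =>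
    mFourierCoeff (FunctionSpaces.EuclideanSpace.complexify ∘ fun x => w τ x j • b τ x) k with hG
  set β : ℝ → ℂ := fun τ => (∑ j, (2 * Real.pi * I * (k j)) * ⟪F j τ, z⟫_ℂ) +
    (A : ℂ) * ∑ j, (2 * Real.pi * I * (k j)) * ⟪G j τ, z⟫_ℂ with hβ
  set γ : ℝ → ℝ := fun τ => ∑ j, (‖F j τ‖ ^ 2 + ‖G j τ‖ ^ 2) with hγ
  have hν0 : 0 ≤ ν' := by
    have := FunctionSpaces.Torus.freqNormSq_nonneg k
    positivity
  have hD0 : 0 ≤ D := by positivity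
  have hαi : IntegrableOn α (Ioo 0 T) := (h.integrableOn_mFourierCoeff k).inner_const z
  have hFi : ∀ j, IntegrableOn (F j) (Ioo 0 T) := fun j => h.integrableOn_mFourierCoeff_carrier_smul j k
  have hGi : ∀ j, IntegrableOn (G j) (Ioo 0 T) := fun j => h.integrableOn_mFourierCoeff_smul_carrier j k
  have hβi : IntegrableOn β (Ioo 0 T) :=
    (integrable_finsetSum _ fun j _ => ((hFi j).inner_const z).const_mul _).add
      ((integrable_finsetSum _ fun j _ => ((hGi j).inner_const z).const_mul _).const_mul _)
  -- `‖F j τ‖², ‖G j τ‖² ≤ M² C` a.e., so `γ` is integrable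
  have hslice := h.ae_tsum_enorm_sq_mFourierCoeff_products_le hM hbM
  have hFG : ∀ j, ∀ᵐ τ ∂(volume.restrict (Ioo 0 T)), ‖F j τ‖ ^ 2 ≤ M ^ 2 * C ∧ ‖G j τ‖ ^ 2 ≤ M ^ 2 * C := by
    intro j
    filter_upwards [hslice, hC] with τ hτ hτC
    have conv : ∀ (X : EuclideanSpace ℂ d), ‖X‖ₑ ^ 2 ≤ ENNReal.ofReal (M ^ 2) * C → ‖X‖ ^ 2 ≤ M ^ 2 * C := by
      intro X hX
      have h2 : ‖X‖ₑ ^ 2 = ENNReal.ofReal (‖X‖ ^ 2) := by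
        rw [← ofReal_norm, ENNReal.ofReal_pow (norm_nonneg _)]
      rw [h2, ← ENNReal.ofReal_coe_nnreal, ← ENNReal.ofReal_mul (sq_nonneg _)] at hX
      exact (ENNReal.ofReal_le_ofReal_iff (by positivity)).1 hX
    refine ⟨conv _ (((ENNReal.le_tsum k).trans (hτ.2 j).1).trans (mul_le_mul_right hτC _)),
      conv _ (((ENNReal.le_tsum k).trans (hτ.2 j).2).trans (mul_le_mul_right hτC _))⟩
  have hγi : IntegrableOn γ (Ioo 0 T) := by
    have hm : AEStronglyMeasurable γ (volume.restrict (Ioo 0 T)) :=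
      Finset.aestronglyMeasurable_fun_sum _ fun j _ =>
        ((hFi j).aestronglyMeasurable.norm.pow 2).add ((hGi j).aestronglyMeasurable.norm.pow 2)
    refine IntegrableOn.of_bound measure_Ioo_lt_top hm (∑ _j : d, (M ^ 2 * C + M ^ 2 * C)) ?_
    have hall : ∀ᵐ τ ∂(volume.restrict (Ioo 0 T)), ∀ j, ‖F j τ‖ ^ 2 ≤ M ^ 2 * C ∧ ‖G j τ‖ ^ 2 ≤ M ^ 2 * C :=
      ae_all_iff.2 fun j => hFG j
    filter_upwards [hall] with τ hτ
    rw [Real.norm_eq_abs, abs_of_nonneg (Finset.sum_nonneg fun j _ => by positivity)]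
    exact Finset.sum_le_sum fun j _ => add_le_add (hτ j).1 (hτ j).2
  have hγ0 : ∀ᵐ τ ∂(volume.restrict (Ioo 0 T)), 0 ≤ γ τ :=
    ae_of_all _ fun τ => Finset.sum_nonneg fun j _ => by positivity
  -- the modewise integral identity with datum `0`
  have heq : ∀ᵐ t ∂(volume.restrict (Ioo 0 T)), α t = ∫ τ in Ioc 0 t, (-(ν' : ℂ) * α τ + β τ) := by
    filter_upwards [h.ae_inner_mFourierCoeff_eq (integrable_zero _ _ _) k hz] with t ht
    rw [hα]
    simp only
    rw [ht, mFourierCoeff_complexify_zero', inner_zero_left, zero_add]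
  -- the bound on `β`
  have hbound : ∀ᵐ τ ∂(volume.restrict (Ioo 0 T)), ‖β τ‖ ^ 2 ≤ 2 * ν' * D * γ τ :=
    ae_of_all _ fun τ => norm_sq_modeRHS_le hν A k z (fun j => F j τ) (fun j => G j τ)
  exact sq_norm_le_of_ae_eq_setIntegral hν0 hD0 hαi hβi hγi hγ0 heq hbound

/-- `k · ŵ(t)(k) = 0` for a.e. `t`: the Fourier coefficients of a weak solution are transversal
(weak incompressibility, `IsWeaklyDivFree.sum_mul_mFourierCoeff_eq_zero`). [cite: Temam1984, Ch. III §1.1] -/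
theorem ae_sum_mul_mFourierCoeff_eq_zero {w₀ : UnitAddTorus d → EuclideanSpace ℝ d}
    (h : IsWeakPassiveVectorOn A T ν b w₀ w) (k : d → ℤ) :
    ∀ᵐ t ∂(volume.restrict (Ioo 0 T)),
      ∑ j, (k j : ℂ) * mFourierCoeff (FunctionSpaces.EuclideanSpace.complexify ∘ w t) k j = 0 := by
  filter_upwards [h.ae_memLp_two, h.ae_isWeaklyDivFree] with t h1 h2
  exact h2.sum_mul_mFourierCoeff_eq_zero h1 k

/-- **Uniform-in-`k` modewise energy bound.** For a weak solution with datum `0`, `ν > 0` and a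
carrier bounded by `M` a.e. on `(0,T) × T^d`: for every `k` and a.e. `t ∈ (0,T)`,
`‖ŵ(t)(k)‖² ≤ (2d(1 + A²)/ν) ∫_{(0,t]} ∑ⱼ (‖𝓕(bⱼ w)(τ)(k)‖² + ‖𝓕(wⱼ b)(τ)(k)‖²) dτ`.
For `k ≠ 0` test with the `d` transversal vectors `z⁽ⁱ⁾ = |k|² eᵢ - kᵢ k` (`‖z⁽ⁱ⁾‖ ≤ 2|k|²`,
`⟪ŵ, z⁽ⁱ⁾⟫ = |k|² conj ŵᵢ` because `k · ŵ = 0`), for `k = 0` with `eᵢ`; sum over `i`.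
[cite: Evans2010, §7.1.2 Thm. 2] -/
theorem ae_sq_norm_mFourierCoeff_le (h : IsWeakPassiveVectorOn A T ν b 0 w) (hν : 0 < ν)
    {M : ℝ} (hM : 0 ≤ M)
    (hbM : ∀ᵐ q ∂(((volume : Measure ℝ).restrict (Ioo 0 T)).prod (volume : Measure (UnitAddTorus d))),
      ‖b q.1 q.2‖ ≤ M) (k : d → ℤ) :
    ∀ᵐ t ∂(volume.restrict (Ioo 0 T)),
      ‖mFourierCoeff (FunctionSpaces.EuclideanSpace.complexify ∘ w t) k‖ ^ 2 ≤
        (2 * Fintype.card d * (1 + A ^ 2) / ν) * ∫ τ in Ioc 0 t, ∑ j,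
          (‖mFourierCoeff (FunctionSpaces.EuclideanSpace.complexify ∘ fun x => b τ x j • w τ x) k‖ ^ 2 +
            ‖mFourierCoeff (FunctionSpaces.EuclideanSpace.complexify ∘ fun x => w τ x j • b τ x) k‖ ^ 2) := by
  set N : ℝ := FunctionSpaces.Torus.freqNormSq k with hN
  -- the test vectors
  set K : EuclideanSpace ℂ d := WithLp.toLp 2 (fun j : d => ((k j : ℤ) : ℂ)) with hK
  set Z : d → EuclideanSpace ℂ d := fun i =>
    ((N : ℝ) : ℂ) • EuclideanSpace.single i (1 : ℂ) - ((k i : ℤ) : ℂ) • K with hZ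
  have hKj : ∀ j, K j = ((k j : ℤ) : ℂ) := fun j => rfl
  have hsumK : ∑ j, ((k j : ℤ) : ℂ) * K j = (N : ℂ) := by
    simp only [hKj, hN, FunctionSpaces.Torus.freqNormSq]
    push_cast
    exact Finset.sum_congr rfl fun j _ => by ring
  have hnormK : ‖K‖ ^ 2 = N := by
    rw [EuclideanSpace.norm_sq_eq, hN, FunctionSpaces.Torus.freqNormSq]
    refine Finset.sum_congr rfl fun j _ => ?_
    rw [hKj, Complex.norm_intCast, sq_abs]
  have hN0 : 0 ≤ N := FunctionSpaces.Torus.freqNormSq_nonneg k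
  -- (Z1) transversality
  have hZtr : ∀ i, ∑ j, ((k j : ℤ) : ℂ) * Z i j = 0 := by
    intro i
    have e : ∀ j, Z i j = ((N : ℝ) : ℂ) * (if j = i then 1 else 0) - ((k i : ℤ) : ℂ) * K j := by
      intro j
      simp only [hZ, PiLp.sub_apply, PiLp.smul_apply, PiLp.single_apply, smul_eq_mul]
    simp_rw [e, mul_sub, Finset.sum_sub_distrib, mul_ite, mul_one, mul_zero, Finset.sum_ite_eq',
      Finset.mem_univ, if_true]
    calc ((k i : ℤ) : ℂ) * (N : ℂ) - ∑ j, ((k j : ℤ) : ℂ) * (((k i : ℤ) : ℂ) * K j)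
        = ((k i : ℤ) : ℂ) * (N : ℂ) - ((k i : ℤ) : ℂ) * ∑ j, ((k j : ℤ) : ℂ) * K j := by
          rw [Finset.mul_sum]
          exact congrArg _ (Finset.sum_congr rfl fun j _ => by ring)
      _ = 0 := by rw [hsumK]; ring
  -- (Z2) pairing with a transversal vector
  have hZin : ∀ (X : EuclideanSpace ℂ d), ∑ j, ((k j : ℤ) : ℂ) * X j = 0 → ∀ i,
      ⟪X, Z i⟫_ℂ = (N : ℂ) * conj (X i) := by
    intro X hX i
    have hXK : ⟪X, K⟫_ℂ = 0 := by
      rw [PiLp.inner_apply]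
      simp only [hKj, RCLike.inner_apply']
      have : ∑ j, conj (X j) * ((k j : ℤ) : ℂ) = conj (∑ j, ((k j : ℤ) : ℂ) * X j) := by
        rw [map_sum]
        exact Finset.sum_congr rfl fun j _ => by rw [map_mul, map_intCast, mul_comm]
      rw [this, hX, map_zero]
    rw [hZ]
    simp only
    rw [inner_sub_right, inner_smul_right, inner_smul_right, EuclideanSpace.inner_single_right, hXK,
      mul_zero, sub_zero, one_mul]
  -- (Z3) size
  have hZnorm : ∀ i, ‖Z i‖ ≤ 2 * N := by
    intro i
    have hKi : ‖((k i : ℤ) : ℂ)‖ ≤ ‖K‖ := by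
      have h1 : ‖((k i : ℤ) : ℂ)‖ ^ 2 ≤ ‖K‖ ^ 2 := by
        rw [EuclideanSpace.norm_sq_eq K]
        exact Finset.single_le_sum (f := fun j => ‖K j‖ ^ 2) (fun j _ => sq_nonneg _) (Finset.mem_univ i)
      exact (pow_le_pow_iff_left₀ (norm_nonneg _) (norm_nonneg _) two_ne_zero).1 h1
    have hKK : ‖K‖ * ‖K‖ = N := by rw [← sq, hnormK]
    calc ‖Z i‖ ≤ ‖((N : ℝ) : ℂ) • EuclideanSpace.single i (1 : ℂ)‖ + ‖((k i : ℤ) : ℂ) • K‖ := norm_sub_le _ _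
      _ = N + ‖((k i : ℤ) : ℂ)‖ * ‖K‖ := by
          rw [norm_smul, norm_smul, PiLp.norm_single, norm_one, mul_one, Complex.norm_real, Real.norm_eq_abs,
            abs_of_nonneg hN0]
      _ ≤ N + ‖K‖ * ‖K‖ := by gcongr
      _ = 2 * N := by rw [hKK]; ring
  -- the per-vector bounds, all at once
  have hdiv := h.ae_sum_mul_mFourierCoeff_eq_zero k
  by_cases hk : k = 0
  · -- `k = 0`: every vector is transversal; test with `eᵢ`
    have he : ∀ i, ∑ j, ((k j : ℤ) : ℂ) * (EuclideanSpace.single i (1 : ℂ) : EuclideanSpace ℂ d) j = 0 := by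
      intro i; simp [hk]
    have hall := ae_all_iff.2 fun i => h.ae_sq_norm_inner_mFourierCoeff_le hν hM hbM k (he i)
    filter_upwards [hall] with t ht
    set X := mFourierCoeff (FunctionSpaces.EuclideanSpace.complexify ∘ w t) k with hX
    set I₀ := ∫ τ in Ioc 0 t, ∑ j,
      (‖mFourierCoeff (FunctionSpaces.EuclideanSpace.complexify ∘ fun x => b τ x j • w τ x) k‖ ^ 2 +
        ‖mFourierCoeff (FunctionSpaces.EuclideanSpace.complexify ∘ fun x => w τ x j • b τ x) k‖ ^ 2) with hI₀
    have hI0 : 0 ≤ I₀ := setIntegral_nonneg measurableSet_Ioc fun τ _ => Finset.sum_nonneg fun j _ => by positivity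
    have hi : ∀ i, ‖X i‖ ^ 2 ≤ ((1 + A ^ 2) / (2 * ν)) * I₀ := by
      intro i
      have := ht i
      rw [EuclideanSpace.inner_single_right, one_mul, Complex.norm_conj, PiLp.norm_single, norm_one, one_pow,
        mul_one] at this
      exact this
    calc ‖X‖ ^ 2 = ∑ i, ‖X i‖ ^ 2 := EuclideanSpace.norm_sq_eq X
      _ ≤ ∑ _i : d, ((1 + A ^ 2) / (2 * ν)) * I₀ := Finset.sum_le_sum fun i _ => hi i
      _ = Fintype.card d * (((1 + A ^ 2) / (2 * ν)) * I₀) := by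
          rw [Finset.sum_const, Finset.card_univ, nsmul_eq_mul]
      _ ≤ (2 * Fintype.card d * (1 + A ^ 2) / ν) * I₀ := by
          have h1 : Fintype.card d * (((1 + A ^ 2) / (2 * ν)) * I₀) =
              (1 / 4) * ((2 * Fintype.card d * (1 + A ^ 2) / ν) * I₀) := by ring
          rw [h1]
          have h3 : (0 : ℝ) ≤ 2 * Fintype.card d * (1 + A ^ 2) / ν := by positivity
          have h2 : 0 ≤ (2 * Fintype.card d * (1 + A ^ 2) / ν) * I₀ := mul_nonneg h3 hI0
          linarith
  · -- `k ≠ 0`: test with the `z⁽ⁱ⁾`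
    have hNpos : 0 < N := by
      rcases hN0.eq_or_lt with h0 | h0
      · exfalso
        apply hk
        funext j
        have hsum0 : ∑ i, ((k i : ℤ) : ℝ) ^ 2 = 0 := by
          rw [hN, FunctionSpaces.Torus.freqNormSq] at h0
          exact h0.symm
        have hj : ((k j : ℤ) : ℝ) ^ 2 = 0 :=
          (Finset.sum_eq_zero_iff_of_nonneg fun i _ => sq_nonneg ((k i : ℤ) : ℝ)).1 hsum0 j (Finset.mem_univ j)
        have hj' : ((k j : ℤ) : ℝ) = 0 := (pow_eq_zero_iff two_ne_zero).1 hj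
        exact_mod_cast hj'
      · exact h0
    have hall := ae_all_iff.2 fun i => h.ae_sq_norm_inner_mFourierCoeff_le hν hM hbM k (hZtr i)
    filter_upwards [hall, hdiv] with t ht htdiv
    set X := mFourierCoeff (FunctionSpaces.EuclideanSpace.complexify ∘ w t) k with hX
    set I₀ := ∫ τ in Ioc 0 t, ∑ j,
      (‖mFourierCoeff (FunctionSpaces.EuclideanSpace.complexify ∘ fun x => b τ x j • w τ x) k‖ ^ 2 +
        ‖mFourierCoeff (FunctionSpaces.EuclideanSpace.complexify ∘ fun x => w τ x j • b τ x) k‖ ^ 2) with hI₀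
    have hI0 : 0 ≤ I₀ := setIntegral_nonneg measurableSet_Ioc fun τ _ => Finset.sum_nonneg fun j _ => by positivity
    have hi : ∀ i, N ^ 2 * ‖X i‖ ^ 2 ≤ ((1 + A ^ 2) * (2 * N) ^ 2 / (2 * ν)) * I₀ := by
      intro i
      have h1 := ht i
      rw [hZin X htdiv i, norm_mul, Complex.norm_conj, Complex.norm_real, Real.norm_eq_abs, abs_of_nonneg hN0,
        mul_pow] at h1
      refine h1.trans (mul_le_mul_of_nonneg_right ?_ hI0)
      gcongr
      exact hZnorm i
    have hsum : N ^ 2 * ‖X‖ ^ 2 ≤ Fintype.card d * (((1 + A ^ 2) * (2 * N) ^ 2 / (2 * ν)) * I₀) := by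
      calc N ^ 2 * ‖X‖ ^ 2 = ∑ i, N ^ 2 * ‖X i‖ ^ 2 := by rw [EuclideanSpace.norm_sq_eq X, Finset.mul_sum]
        _ ≤ ∑ _i : d, ((1 + A ^ 2) * (2 * N) ^ 2 / (2 * ν)) * I₀ := Finset.sum_le_sum fun i _ => hi i
        _ = Fintype.card d * (((1 + A ^ 2) * (2 * N) ^ 2 / (2 * ν)) * I₀) := by
            rw [Finset.sum_const, Finset.card_univ, nsmul_eq_mul]
    have e : Fintype.card d * (((1 + A ^ 2) * (2 * N) ^ 2 / (2 * ν)) * I₀) =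
        N ^ 2 * ((2 * Fintype.card d * (1 + A ^ 2) / ν) * I₀) := by ring
    rw [e] at hsum
    have hN2 : 0 < N ^ 2 := by positivity
    exact le_of_mul_le_mul_left hsum hN2

/-- **A weak passive-vector / linearised Navier–Stokes solution with datum `0` and bounded carrier
vanishes** (`ν > 0`, `b ∈ L^∞((0,T) × T^d)`, any `A`): `w(t) = 0` a.e. for a.e. `t ∈ (0,T)`.
Summing the modewise bounds over `k` (Parseval for vector fields, Tonelli) gives
`‖w(t)‖²_{L²} ≤ (4dM²(1+A²)d/ν) ∫₀ᵗ ‖w‖²_{L²}` for a.e. `t`, and Grönwall a.e. in time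
(`ae_gronwall_const`) concludes. [cite: Evans2010, §7.1.2 Thm. 2] -/
theorem ae_eq_zero_of_memLp_top (h : IsWeakPassiveVectorOn A T ν b 0 w) (hν : 0 < ν)
    (hb : MemLp (FunctionSpaces.Torus.stLift b) ∞ (volume.restrict (Ioo 0 T ×ˢ univ))) :
    ∀ᵐ t ∂(volume.restrict (Ioo 0 T)), w t =ᵐ[volume] 0 := by
  obtain ⟨M, hM, hbM⟩ := ae_norm_le_prod_of_memLp_top_stLift'' hb
  obtain ⟨C, hC⟩ := h.ae_lintegral_sq_le
  set D : ℝ := 2 * Fintype.card d * (1 + A ^ 2) / ν with hD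
  have hD0 : 0 ≤ D := by positivity
  set Φ : ℝ → ℝ≥0∞ := fun t => ∫⁻ x, ‖w t x‖ₑ ^ 2 with hΦ
  set F : d → (d → ℤ) → ℝ → EuclideanSpace ℂ d := fun j k τ =>
    mFourierCoeff (FunctionSpaces.EuclideanSpace.complexify ∘ fun x => b τ x j • w τ x) k with hF
  set G : d → (d → ℤ) → ℝ → EuclideanSpace ℂ d := fun j k τ =>
    mFourierCoeff (FunctionSpaces.EuclideanSpace.complexify ∘ fun x => w τ x j • b τ x) k with hG
  have hFi : ∀ j k, IntegrableOn (F j k) (Ioo 0 T) := fun j k => h.integrableOn_mFourierCoeff_carrier_smul j k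
  have hGi : ∀ j k, IntegrableOn (G j k) (Ioo 0 T) := fun j k => h.integrableOn_mFourierCoeff_smul_carrier j k
  have hslice := h.ae_tsum_enorm_sq_mFourierCoeff_products_le hM hbM
  -- Plancherel bound for the fluxes: `∑ₖ γₖ(τ) ≤ 2 d M² Φ τ` a.e.
  have hflux : ∀ᵐ τ ∂(volume.restrict (Ioo 0 T)),
      ∑' k, ∑ j, (‖F j k τ‖ₑ ^ 2 + ‖G j k τ‖ₑ ^ 2) ≤ (Fintype.card d : ℝ≥0∞) * (2 * (ENNReal.ofReal (M ^ 2) * Φ τ)) := by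
    filter_upwards [hslice] with τ hτ
    rw [Summable.tsum_finsetSum (fun _ _ => ENNReal.summable)]
    calc ∑ j, ∑' k, (‖F j k τ‖ₑ ^ 2 + ‖G j k τ‖ₑ ^ 2)
        ≤ ∑ _j : d, 2 * (ENNReal.ofReal (M ^ 2) * Φ τ) := by
          refine Finset.sum_le_sum fun j _ => ?_
          rw [ENNReal.tsum_add, two_mul]
          exact add_le_add (hτ.2 j).1 (hτ.2 j).2
      _ = (Fintype.card d : ℝ≥0∞) * (2 * (ENNReal.ofReal (M ^ 2) * Φ τ)) := by
          rw [Finset.sum_const, Finset.card_univ, nsmul_eq_mul]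
  -- all modewise bounds at once
  have hmodes : ∀ᵐ t ∂(volume.restrict (Ioo 0 T)), ∀ k : d → ℤ,
      ‖mFourierCoeff (FunctionSpaces.EuclideanSpace.complexify ∘ w t) k‖ ^ 2 ≤
        D * ∫ τ in Ioc 0 t, ∑ j, (‖F j k τ‖ ^ 2 + ‖G j k τ‖ ^ 2) :=
    ae_all_iff.2 fun k => h.ae_sq_norm_mFourierCoeff_le hν hM hbM k
  -- integrability of the `γₖ`
  have hγi : ∀ k, IntegrableOn (fun τ => ∑ j, (‖F j k τ‖ ^ 2 + ‖G j k τ‖ ^ 2)) (Ioo 0 T) := by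
    intro k
    have hm : AEStronglyMeasurable (fun τ => ∑ j, (‖F j k τ‖ ^ 2 + ‖G j k τ‖ ^ 2)) (volume.restrict (Ioo 0 T)) :=
      Finset.aestronglyMeasurable_fun_sum _ fun j _ =>
        ((hFi j k).aestronglyMeasurable.norm.pow 2).add ((hGi j k).aestronglyMeasurable.norm.pow 2)
    refine IntegrableOn.of_bound measure_Ioo_lt_top hm (∑ _j : d, (M ^ 2 * C + M ^ 2 * C)) ?_
    filter_upwards [hslice, hC] with τ hτ hτC
    rw [Real.norm_eq_abs, abs_of_nonneg (Finset.sum_nonneg fun j _ => by positivity)]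
    refine Finset.sum_le_sum fun j _ => ?_
    have conv : ∀ (X : EuclideanSpace ℂ d), ‖X‖ₑ ^ 2 ≤ ENNReal.ofReal (M ^ 2) * C → ‖X‖ ^ 2 ≤ M ^ 2 * C := by
      intro X hX
      have h2 : ‖X‖ₑ ^ 2 = ENNReal.ofReal (‖X‖ ^ 2) := by
        rw [← ofReal_norm, ENNReal.ofReal_pow (norm_nonneg _)]
      rw [h2, ← ENNReal.ofReal_coe_nnreal, ← ENNReal.ofReal_mul (sq_nonneg _)] at hX
      exact (ENNReal.ofReal_le_ofReal_iff (by positivity)).1 hX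
    exact add_le_add (conv _ (((ENNReal.le_tsum k).trans (hτ.2 j).1).trans (mul_le_mul_right hτC _)))
      (conv _ (((ENNReal.le_tsum k).trans (hτ.2 j).2).trans (mul_le_mul_right hτC _)))
  -- the integral inequality for `Φ`
  set L : ℝ≥0∞ := ENNReal.ofReal D * ((Fintype.card d : ℝ≥0∞) * (2 * ENNReal.ofReal (M ^ 2))) with hL
  have hLtop : L ≠ ⊤ := by
    rw [hL]
    exact ENNReal.mul_ne_top ENNReal.ofReal_ne_top
      (ENNReal.mul_ne_top (ENNReal.natCast_ne_top _) (ENNReal.mul_ne_top ENNReal.ofNat_ne_top ENNReal.ofReal_ne_top))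
  have hΦ : ∀ᵐ t ∂(volume.restrict (Ioo 0 T)), Φ t ≤ 0 + L * ∫⁻ τ in Ioo 0 t, Φ τ := by
    filter_upwards [hmodes, hslice, ae_restrict_mem measurableSet_Ioo] with t ht hts htT
    rw [zero_add]
    have hsub : Ioc 0 t ⊆ Ioo 0 T := fun τ hτ => ⟨hτ.1, hτ.2.trans_lt htT.2⟩
    -- `Φ t = ∑ₖ ‖ŵₖ(t)‖ₑ²`
    rw [hΦ]
    simp only
    rw [← FunctionSpaces.Torus.tsum_enorm_sq_mFourierCoeff_complexify hts.1]
    -- modewise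
    have hk : ∀ k, ‖mFourierCoeff (FunctionSpaces.EuclideanSpace.complexify ∘ w t) k‖ₑ ^ 2 ≤
        ENNReal.ofReal D * ∫⁻ τ in Ioc 0 t, ∑ j, (‖F j k τ‖ₑ ^ 2 + ‖G j k τ‖ₑ ^ 2) := by
      intro k
      have hγt : Integrable (fun τ => ∑ j, (‖F j k τ‖ ^ 2 + ‖G j k τ‖ ^ 2)) (volume.restrict (Ioc 0 t)) :=
        (hγi k).mono_set hsub
      have e1 : ‖mFourierCoeff (FunctionSpaces.EuclideanSpace.complexify ∘ w t) k‖ₑ ^ 2 =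
          ENNReal.ofReal (‖mFourierCoeff (FunctionSpaces.EuclideanSpace.complexify ∘ w t) k‖ ^ 2) := by
        rw [← ofReal_norm, ENNReal.ofReal_pow (norm_nonneg _)]
      have e2 : ∫⁻ τ in Ioc 0 t, ∑ j, (‖F j k τ‖ₑ ^ 2 + ‖G j k τ‖ₑ ^ 2) =
          ∫⁻ τ in Ioc 0 t, ENNReal.ofReal (∑ j, (‖F j k τ‖ ^ 2 + ‖G j k τ‖ ^ 2)) := by
        refine lintegral_congr fun τ => ?_
        rw [ENNReal.ofReal_sum_of_nonneg (fun j _ => by positivity)]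
        refine Finset.sum_congr rfl fun j _ => ?_
        rw [ENNReal.ofReal_add (sq_nonneg _) (sq_nonneg _), ← ofReal_norm, ENNReal.ofReal_pow (norm_nonneg _),
          ← ofReal_norm, ENNReal.ofReal_pow (norm_nonneg _)]
      rw [e1, e2, ← ofReal_integral_eq_lintegral_ofReal hγt
          (ae_of_all _ fun τ => Finset.sum_nonneg fun j _ => by positivity), ← ENNReal.ofReal_mul hD0]
      exact ENNReal.ofReal_le_ofReal (ht k)
    -- sum over `k` and exchange with the time integral
    have hmeas : ∀ k, AEMeasurable (fun τ => ∑ j, (‖F j k τ‖ₑ ^ 2 + ‖G j k τ‖ₑ ^ 2)) (volume.restrict (Ioc 0 t)) := by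
      intro k
      refine Finset.aemeasurable_fun_sum _ fun j _ => ?_
      exact (((hFi j k).aestronglyMeasurable.aemeasurable.mono_set hsub).enorm.pow_const 2).add
        (((hGi j k).aestronglyMeasurable.aemeasurable.mono_set hsub).enorm.pow_const 2)
    calc ∑' k, ‖mFourierCoeff (FunctionSpaces.EuclideanSpace.complexify ∘ w t) k‖ₑ ^ 2
        ≤ ∑' k, ENNReal.ofReal D * ∫⁻ τ in Ioc 0 t, ∑ j, (‖F j k τ‖ₑ ^ 2 + ‖G j k τ‖ₑ ^ 2) :=
          ENNReal.tsum_le_tsum hk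
      _ = ENNReal.ofReal D * ∫⁻ τ in Ioc 0 t, ∑' k, ∑ j, (‖F j k τ‖ₑ ^ 2 + ‖G j k τ‖ₑ ^ 2) := by
          rw [ENNReal.tsum_mul_left, lintegral_tsum hmeas]
      _ ≤ ENNReal.ofReal D * ∫⁻ τ in Ioc 0 t, (Fintype.card d : ℝ≥0∞) * (2 * (ENNReal.ofReal (M ^ 2) * Φ τ)) := by
          gcongr 1
          exact lintegral_mono_ae (ae_restrict_of_ae_restrict_of_subset hsub hflux)
      _ = L * ∫⁻ τ in Ioo 0 t, Φ τ := by
          rw [lintegral_const_mul' _ _ (ENNReal.natCast_ne_top _),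
            lintegral_const_mul' _ _ ENNReal.ofNat_ne_top,
            lintegral_const_mul' _ _ ENNReal.ofReal_ne_top,
            setLIntegral_congr (Ioo_ae_eq_Ioc (μ := (volume : Measure ℝ))), hL]
          ring
  have hΦC : ∀ᵐ t ∂(volume.restrict (Ioo 0 T)), Φ t ≤ (C : ℝ≥0∞) := hC
  have hGr := ae_gronwall_const (S := T) (φ := Φ) (B := 0) (M := C) (L := L) (by simp) ENNReal.coe_ne_top hLtop hΦC hΦ
  -- conclusion
  filter_upwards [hGr, h.aestronglyMeasurable_uncurry.prodMk_left] with t ht hm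
  have h0 : Φ t = 0 := le_antisymm (by simpa using ht) bot_le
  have hae : ∀ᵐ x ∂volume, ‖w t x‖ₑ ^ 2 = 0 :=
    (lintegral_eq_zero_iff' (hm.enorm.pow_const 2)).1 h0
  filter_upwards [hae] with x hx
  have hx' : ‖w t x‖ₑ = 0 := by simpa using hx
  simpa [enorm_eq_zero] using hx'

end IsWeakPassiveVectorOn

end ModeBound

/-! ## Uniqueness -/

section Uniqueness

variable [DecidableEq d]

namespace IsWeakPassiveVectorOn

variable {A T ν : ℝ} {b w₁ w₂ : ℝ → UnitAddTorus d → EuclideanSpace ℝ d} {w₀ : UnitAddTorus d → EuclideanSpace ℝ d}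

/-- `‖b‖ ‖w₁ - w₂‖ ∈ L¹((0,T) × T^d)` in the iterated-`lintegral` form of the solution class.
[cite: DiPernaLions1989, §II.1] -/
theorem lintegral_mul_sub_lt_top (h₁ : IsWeakPassiveVectorOn A T ν b w₀ w₁)
    (h₂ : IsWeakPassiveVectorOn A T ν b w₀ w₂) :
    ∫⁻ t in Ioo 0 T, ∫⁻ x, ‖b t x‖ₑ * ‖w₁ t x - w₂ t x‖ₑ < ⊤ := by
  set μT : Measure ℝ := (volume : Measure ℝ).restrict (Ioo 0 T) with hμT
  have hmu := h₁.aestronglyMeasurable_uncurry_carrier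
  have hm₁ := h₁.aestronglyMeasurable_uncurry
  have hm₂ := h₂.aestronglyMeasurable_uncurry
  have hF : AEMeasurable (fun p : ℝ × UnitAddTorus d => ‖b p.1 p.2‖ₑ * ‖w₁ p.1 p.2 - w₂ p.1 p.2‖ₑ)
      (μT.prod volume) := hmu.enorm.mul (hm₁.sub hm₂).enorm
  have hF₁ : AEMeasurable (fun p : ℝ × UnitAddTorus d => ‖b p.1 p.2‖ₑ * ‖w₁ p.1 p.2‖ₑ) (μT.prod volume) :=
    hmu.enorm.mul hm₁.enorm
  have hF₂ : AEMeasurable (fun p : ℝ × UnitAddTorus d => ‖b p.1 p.2‖ₑ * ‖w₂ p.1 p.2‖ₑ) (μT.prod volume) :=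
    hmu.enorm.mul hm₂.enorm
  have e : ∫⁻ t in Ioo 0 T, ∫⁻ x, ‖b t x‖ₑ * ‖w₁ t x - w₂ t x‖ₑ =
      ∫⁻ p, ‖b p.1 p.2‖ₑ * ‖w₁ p.1 p.2 - w₂ p.1 p.2‖ₑ ∂(μT.prod volume) := (lintegral_prod _ hF).symm
  rw [e]
  calc ∫⁻ p, ‖b p.1 p.2‖ₑ * ‖w₁ p.1 p.2 - w₂ p.1 p.2‖ₑ ∂(μT.prod volume)
      ≤ ∫⁻ p, (‖b p.1 p.2‖ₑ * ‖w₁ p.1 p.2‖ₑ + ‖b p.1 p.2‖ₑ * ‖w₂ p.1 p.2‖ₑ) ∂(μT.prod volume) := by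
        refine lintegral_mono fun p => ?_
        rw [← mul_add]
        gcongr
        exact enorm_sub_le
    _ = (∫⁻ p, ‖b p.1 p.2‖ₑ * ‖w₁ p.1 p.2‖ₑ ∂(μT.prod volume)) +
          ∫⁻ p, ‖b p.1 p.2‖ₑ * ‖w₂ p.1 p.2‖ₑ ∂(μT.prod volume) := lintegral_add_left' hF₁ _
    _ = (∫⁻ t in Ioo 0 T, ∫⁻ x, ‖b t x‖ₑ * ‖w₁ t x‖ₑ) + ∫⁻ t in Ioo 0 T, ∫⁻ x, ‖b t x‖ₑ * ‖w₂ t x‖ₑ := by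
        rw [lintegral_prod _ hF₁, lintegral_prod _ hF₂]
    _ < ⊤ := ENNReal.add_lt_top.2 ⟨h₁.lintegral_mul_lt_top, h₂.lintegral_mul_lt_top⟩

/-- `w₁ - w₂ ∈ L^∞(0,T; L²)`: `∫ ‖w₁(t) - w₂(t)‖² ≤ (C₁ + C₂)²` for a.e. `t`. [cite: DiPernaLions1989, §II.1] -/
theorem ae_lintegral_sq_sub_le (h₁ : IsWeakPassiveVectorOn A T ν b w₀ w₁)
    (h₂ : IsWeakPassiveVectorOn A T ν b w₀ w₂) :
    ∃ C : ℝ≥0, ∀ᵐ t ∂(volume.restrict (Ioo 0 T)), ∫⁻ x, ‖w₁ t x - w₂ t x‖ₑ ^ 2 ≤ C := by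
  obtain ⟨C₁, hC₁⟩ := h₁.exists_eLpNorm_le
  obtain ⟨C₂, hC₂⟩ := h₂.exists_eLpNorm_le
  refine ⟨(C₁ + C₂) ^ 2, ?_⟩
  filter_upwards [hC₁, hC₂, h₁.ae_memLp_two, h₂.ae_memLp_two] with t hc₁ hc₂ hm₁ hm₂
  have hsub : eLpNorm (w₁ t - w₂ t) 2 volume ≤ C₁ + C₂ :=
    (eLpNorm_sub_le hm₁.1 hm₂.1 one_le_two).trans (add_le_add hc₁ hc₂)
  have e : ∫⁻ x, ‖w₁ t x - w₂ t x‖ₑ ^ 2 = eLpNorm (w₁ t - w₂ t) 2 volume ^ 2 := by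
    rw [eLpNorm_two_pow_two'']
    rfl
  rw [e, ENNReal.coe_pow, ENNReal.coe_add]
  exact pow_le_pow_left' hsub 2

/-- **Linearity of the weak passive-vector class**: the difference of two weak solutions with the
same carrier, coupling `A`, viscosity and datum is a weak solution with datum `0`.
[cite: DiPernaLions1989, §II.1] -/
theorem sub_of_eq (h₁ : IsWeakPassiveVectorOn A T ν b w₀ w₁) (h₂ : IsWeakPassiveVectorOn A T ν b w₀ w₂) :
    IsWeakPassiveVectorOn A T ν b 0 (fun t x => w₁ t x - w₂ t x) where
  aestronglyMeasurable := h₁.aestronglyMeasurable.sub h₂.aestronglyMeasurable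
  aestronglyMeasurable_carrier := h₁.aestronglyMeasurable_carrier
  ae_lintegral_sq_le := ae_lintegral_sq_sub_le h₁ h₂
  lintegral_carrier_lt_top := h₁.lintegral_carrier_lt_top
  lintegral_mul_lt_top := lintegral_mul_sub_lt_top h₁ h₂
  ae_isWeaklyDivFree_carrier := h₁.ae_isWeaklyDivFree_carrier
  ae_isWeaklyDivFree := by
    filter_upwards [h₁.ae_isWeaklyDivFree, h₂.ae_isWeaklyDivFree, h₁.ae_memLp_two, h₂.ae_memLp_two]
      with t hd₁ hd₂ hm₁ hm₂
    exact isWeaklyDivFree_sub' hd₁ hd₂ (hm₁.integrable one_le_two) (hm₂.integrable one_le_two)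
  weak_eq Ψ hΨ hΨdiv := by
    have e₁ := h₁.weak_eq Ψ hΨ hΨdiv
    have e₂ := h₂.weak_eq Ψ hΨ hΨdiv
    have hI₁ := h₁.integrable_weakIntegrand hΨ
    have hI₂ := h₂.integrable_weakIntegrand hΨ
    have hpt : ∀ t x, ⟪w₁ t x - w₂ t x, FunctionSpaces.Torus.timeDeriv Ψ t x +
          FunctionSpaces.Torus.convect (b t) (Ψ t) x + ν • FunctionSpaces.Torus.laplacian (Ψ t) x⟫_ℝ +
        A * ⟪b t x, FunctionSpaces.Torus.convect (fun y => w₁ t y - w₂ t y) (Ψ t) x⟫_ℝ =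
        (⟪w₁ t x, FunctionSpaces.Torus.timeDeriv Ψ t x +
            FunctionSpaces.Torus.convect (b t) (Ψ t) x + ν • FunctionSpaces.Torus.laplacian (Ψ t) x⟫_ℝ +
          A * ⟪b t x, FunctionSpaces.Torus.convect (w₁ t) (Ψ t) x⟫_ℝ) -
        (⟪w₂ t x, FunctionSpaces.Torus.timeDeriv Ψ t x +
            FunctionSpaces.Torus.convect (b t) (Ψ t) x + ν • FunctionSpaces.Torus.laplacian (Ψ t) x⟫_ℝ +
          A * ⟪b t x, FunctionSpaces.Torus.convect (w₂ t) (Ψ t) x⟫_ℝ) := by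
      intro t x
      simp only [FunctionSpaces.Torus.convect, map_sub, inner_sub_left, inner_sub_right]
      ring
    have hslice : ∀ᵐ t ∂(volume.restrict (Ioo 0 T)),
        ∫ x, (⟪w₁ t x - w₂ t x, FunctionSpaces.Torus.timeDeriv Ψ t x +
            FunctionSpaces.Torus.convect (b t) (Ψ t) x + ν • FunctionSpaces.Torus.laplacian (Ψ t) x⟫_ℝ +
          A * ⟪b t x, FunctionSpaces.Torus.convect (fun y => w₁ t y - w₂ t y) (Ψ t) x⟫_ℝ) =
        (∫ x, (⟪w₁ t x, FunctionSpaces.Torus.timeDeriv Ψ t x +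
            FunctionSpaces.Torus.convect (b t) (Ψ t) x + ν • FunctionSpaces.Torus.laplacian (Ψ t) x⟫_ℝ +
          A * ⟪b t x, FunctionSpaces.Torus.convect (w₁ t) (Ψ t) x⟫_ℝ)) -
        ∫ x, (⟪w₂ t x, FunctionSpaces.Torus.timeDeriv Ψ t x +
            FunctionSpaces.Torus.convect (b t) (Ψ t) x + ν • FunctionSpaces.Torus.laplacian (Ψ t) x⟫_ℝ +
          A * ⟪b t x, FunctionSpaces.Torus.convect (w₂ t) (Ψ t) x⟫_ℝ) := by
      filter_upwards [hI₁.prod_right_ae, hI₂.prod_right_ae] with t ht₁ ht₂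
      rw [← integral_sub ht₁ ht₂]
      exact integral_congr_ae (Eventually.of_forall fun x => hpt t x)
    have key : (∫ t in Ioo 0 T, ∫ x, (⟪w₁ t x - w₂ t x, FunctionSpaces.Torus.timeDeriv Ψ t x +
            FunctionSpaces.Torus.convect (b t) (Ψ t) x + ν • FunctionSpaces.Torus.laplacian (Ψ t) x⟫_ℝ +
          A * ⟪b t x, FunctionSpaces.Torus.convect (fun y => w₁ t y - w₂ t y) (Ψ t) x⟫_ℝ)) +
        ∫ x, ⟪(0 : UnitAddTorus d → EuclideanSpace ℝ d) x, Ψ 0 x⟫_ℝ = 0 := by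
      rw [integral_congr_ae hslice, integral_sub hI₁.integral_prod_left hI₂.integral_prod_left]
      simp only [Pi.zero_apply, inner_zero_left, integral_zero, add_zero]
      linarith
    exact key

/-- **Uniqueness of weak passive-vector / linearised Navier–Stokes solutions with bounded carrier.**
For `ν > 0`, any coupling `A` and a carrier `b ∈ L^∞((0,T) × T^d)`, two weak solutions
`w₁, w₂ ∈ L^∞_t L²_x` of `∂ₜw + (b·∇)w + A (w·∇)b + ∇π = νΔw`, `∇·w = 0` (weak form of
Yoshida–Kaneda 2000, (4)–(5), tested against smooth divergence-free fields) with the same datum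
coincide for a.e. `t ∈ (0,T)`: their difference solves the problem from datum `0` (`sub_of_eq`) and
vanishes by `ae_eq_zero_of_memLp_top` (modewise energy method, Evans 2010 §7.1.2 Thm. 2, and
Grönwall; the passive-vector analogue of Bonicatto–Ciampa–Crippa 2024, Cor. 3.5, `p = ∞, q = 2`).
[cite: Evans2010, §7.1.2 Thm. 2] -/
theorem ae_eq_of_memLp_top (hν : 0 < ν)
    (h₁ : IsWeakPassiveVectorOn A T ν b w₀ w₁) (h₂ : IsWeakPassiveVectorOn A T ν b w₀ w₂)
    (hb : MemLp (FunctionSpaces.Torus.stLift b) ∞ (volume.restrict (Ioo 0 T ×ˢ univ))) :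
    ∀ᵐ t ∂(volume.restrict (Ioo 0 T)), w₁ t =ᵐ[volume] w₂ t := by
  filter_upwards [(sub_of_eq h₁ h₂).ae_eq_zero_of_memLp_top hν hb] with t ht
  filter_upwards [ht] with x hx
  exact sub_eq_zero.1 hx

end IsWeakPassiveVectorOn

end Uniqueness

end Torus

end Literature.Analysis.FluidPDE

end
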